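import Summits.AtomisticToContinuum.HydrodynamicLimit.Theses.TwoClocks
import Summits.AtomisticToContinuum.HydrodynamicLimit.Theorems.ImplosionDichotomyHydroLimitInBandOfHeart
import Summits.AtomisticToContinuum.HydrodynamicLimit.Theorems.ImplosionDichotomyHydroLimitInBandSplit
import Summits.AtomisticToContinuum.HydrodynamicLimit.Theorems.TwoClocksTransferEntropyClockFamilyNodesReduction
import Summits.AtomisticToContinuum.HydrodynamicLimit.Theorems.TwoClocksTransferEntropyClockRestated
import Summits.AtomisticToContinuum.HydrodynamicLimit.Theorems.TwoClocksTransferEntropyClockOneWindowLedger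
import Summits.AtomisticToContinuum.HydrodynamicLimit.Theorems.TwoClocksTransferEntropyClockWindowUpgrade
import Summits.AtomisticToContinuum.HydrodynamicLimit.Theorems.TwoClocksTransferEntropyClockEquilibriumFamily
import Summits.AtomisticToContinuum.HydrodynamicLimit.Theorems.TwoClocksTransferEntropyClockOddWindowLLN
import HarnessLib

/-!
# The clock of route TwoClocks restated over the bounded odd window LLN, and the split glue of skeleton v9 (line `Sketch`, crux stmt-AtomisticToContinuum-16625; support file)

Kernel-checked records for the planner's restate/split of crux 16625
(`TwoClocks.TransferEntropyClock = KineticWindowLDUniform → ClampedTransferWindowLD → TransferActivityTails →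
EnergyCurrentTails → DiluteSelfConsistency → _root_.HydrodynamicLimit`), after the reshape of the coherence stub
(skeleton v8/v9, lead c5): the heart's weighted coherence input `CoherentSuprathermalContentVanishesW` is recovered from the
cleaner node `TransferEntropyClockOddWindowLLN.BoundedOddWindowLLN` (tagged-particle window LLN for bounded odd functionals
of the peculiar velocity under the true pre-shock law) and the crux's fourth antecedent `EnergyCurrentTails` by the landed
glue `TransferEntropyClockOddWindowLLN.stub_coherenceOfOddWindowLLN` (p140531). Hence:

* `hydrodynamicLimit_of_familyNodes_of_oddWindowLLN` — the RESTATED CLOCK with the coherence node replaced: the sub-problem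
  Statement from `KineticCurrentsWindowLDFamily`, `LocalClampedTransferWindowLDFamily`, `BoundedOddWindowLLN` and the two
  true-law tail antecedents `TransferActivityTails`, `EnergyCurrentTails` (composition of p138788 with p140531);
* `transferEntropyClock_of_nodes` — the crux by name from the three nodes (KWLDU, C′, DSC idle; TA, ECT consumed);
* `transferEntropyClock_of_children` — the crux by name from the three OPEN STUBS OF SKELETON v9 as typed there
  (S3b `EquilibriumKineticLDFamily → KineticCurrentsWindowLDFamily`, S4 `ClampedTransferWindowLD → TransferActivityTails →
  LocalClampedTransferWindowLDFamily`, S5′ `BoundedOddWindowLLN`): KWLDU is consumed through the landed window upgrade S3x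
  (`TransferEntropyClockWindows.stub_windowUpgrade`, p135645) and the landed equilibrium-family theorem S3a
  (`TransferEntropyClockFrame.stub_equilibriumFamily`, p136147), C′ and TA through S4, ECT through p140531 — this is
  `TransferEntropyClockLine.TransferEntropyClock_of` of `Cruxes/TransferEntropyClock/Lines/Sketch.lean` v9 with its three
  sorried stubs abstracted into hypotheses, i.e. the `--glue-by` theorem for a split of 16625 into exactly those three children;
* `stub_familyNodesReduction : FamilyNodesReduction` — the glue stub S1 of skeleton v3 (lead c1), still registered on the item and
  never closed BY NAME (its content landed as `TransferEntropyClockHeart.stub_transferEntropyClockOfFamilyNodes`, p136222): closed here.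
Lead prover-line-stmt-AtomisticToContinuum-16625-c5-0, cycle 2.
-/

namespace Summit.AtomisticToContinuum.HydrodynamicLimit.Theorems.TransferEntropyClockRestatedOdd

open Summit.AtomisticToContinuum.HydrodynamicLimit.Theses
open Summit.AtomisticToContinuum.HydrodynamicLimit.Theorems.HydroLimitInBandOfHeart
  (LocalClampedTransferWindowLDFamily CoherentSuprathermalContentVanishesW KineticCurrentsWindowLDFamily)
open Summit.AtomisticToContinuum.HydrodynamicLimit.Theorems.TransferEntropyClockFrame
  (EquilibriumKineticLDFamily stub_equilibriumFamily)
open Summit.AtomisticToContinuum.HydrodynamicLimit.Theorems.TransferEntropyClockOddWindowLLN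
  (BoundedOddWindowLLN stub_coherenceOfOddWindowLLN)
open Summit.AtomisticToContinuum.HydrodynamicLimit.Theorems.TransferEntropyClockRestated
  (hydrodynamicLimit_of_familyNodes_of_tails)
open Summit.AtomisticToContinuum.HydrodynamicLimit.Theorems.TransferEntropyClockFamilyNodes
  (transferEntropyClock_of_heart_of_familyNodes)

/-- **S1 of skeleton v3 (line `Sketch`, lead c1), registered signature `FamilyNodesReduction`**: the clock from the heart's three
family-uniform nodes (kinetic family node, local clamped-transfer family node, weighted coherence input). -/
def FamilyNodesReduction : Prop :=
  KineticCurrentsWindowLDFamily → LocalClampedTransferWindowLDFamily → CoherentSuprathermalContentVanishesW →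
    TwoClocks.TransferEntropyClock

/-- **Registered stub `stub_familyNodesReduction` (S1 of skeleton v3), by name and signature** — the landed split glue
`TransferEntropyClockHeart.stub_transferEntropyClockOfFamilyNodes` (p136222) over the sorry-free heart. [cite: Yau1991, §2] -/
theorem stub_familyNodesReduction : FamilyNodesReduction :=
  TransferEntropyClockHeart.stub_transferEntropyClockOfFamilyNodes

/-- **The restated clock over the bounded odd window LLN**: the sub-problem Statement from the kinetic family node, the
local clamped-transfer family node, the bounded odd window LLN and the two true-law tail inputs — the landed restated clock
`hydrodynamicLimit_of_familyNodes_of_tails` (p138788) with its coherence hypothesis discharged by the landed glue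
`stub_coherenceOfOddWindowLLN` (p140531) from the node and `EnergyCurrentTails`. [cite: Yau1991, §2] -/
theorem hydrodynamicLimit_of_familyNodes_of_oddWindowLLN :
    KineticCurrentsWindowLDFamily → LocalClampedTransferWindowLDFamily → BoundedOddWindowLLN →
      TwoClocks.TransferActivityTails → TwoClocks.EnergyCurrentTails → _root_.HydrodynamicLimit :=
  fun hK hL hO h₇ h₆ =>
    hydrodynamicLimit_of_familyNodes_of_tails hK hL (stub_coherenceOfOddWindowLLN hO h₆) h₇ h₆

/-- **The crux by name from the three nodes** (kinetic family node, local clamped-transfer family node, bounded odd window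
LLN): `KineticWindowLDUniform`, `ClampedTransferWindowLD` and `DiluteSelfConsistency` are idle, `TransferActivityTails` and
`EnergyCurrentTails` are consumed by the heart and by the coherence glue. [cite: Yau1991, §2] -/
theorem transferEntropyClock_of_nodes :
    KineticCurrentsWindowLDFamily → LocalClampedTransferWindowLDFamily → BoundedOddWindowLLN →
      TwoClocks.TransferEntropyClock :=
  fun hK hL hO _ _ h₇ h₆ _ => hydrodynamicLimit_of_familyNodes_of_oddWindowLLN hK hL hO h₇ h₆

/-- **The split glue of skeleton v9 (line `Sketch`)**: the crux by name from its three open stubs AS TYPED in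
`Cruxes/TransferEntropyClock/Lines/Sketch.lean` v9 — S3b (locality + density direction of the kinetic node, from the landed
equilibrium family node), S4 (localisation of C′ priced by the transfer-activity tails), S5′ (bounded odd window LLN). The
first antecedent KWLDU is consumed through the landed S3x window upgrade and S3a equilibrium-family theorem, C′ and TA through
S4, ECT through the landed coherence glue, over the sorry-free shared heart `HydroLimitInBandSplit.oneWindowLedger_holds`.
This is `TransferEntropyClockLine.TransferEntropyClock_of` with its stubs abstracted (`--glue-by` candidate). [cite: Yau1991, §2] -/
theorem transferEntropyClock_of_children :
    (EquilibriumKineticLDFamily → KineticCurrentsWindowLDFamily) →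
      (TwoClocks.ClampedTransferWindowLD → TwoClocks.TransferActivityTails → LocalClampedTransferWindowLDFamily) →
        BoundedOddWindowLLN → TwoClocks.TransferEntropyClock :=
  fun hS3b hS4 hS5 hKW h₃ h₇ h₆ hS =>
    transferEntropyClock_of_heart_of_familyNodes HydroLimitInBandSplit.oneWindowLedger_holds
      (hS3b (stub_equilibriumFamily
        (show TransferEntropyClockFrame.WindowUpgrade from TransferEntropyClockWindows.stub_windowUpgrade) hKW))
      (hS4 h₃ h₇) (stub_coherenceOfOddWindowLLN hS5 h₆) hKW h₃ h₇ h₆ hS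

end Summit.AtomisticToContinuum.HydrodynamicLimit.Theorems.TransferEntropyClockRestatedOdd
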